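import Mathlib
import Summits.ResolutionOfSingularities.ResolutionOfSingularities.Theorems.HomologicalConductorNoZenoG2Assembly
import Summits.ResolutionOfSingularities.ResolutionOfSingularities.Theorems.HomologicalConductorNoZenoFullSheafLocallyFreeGW
import Summits.ResolutionOfSingularities.ResolutionOfSingularities.Theorems.HomologicalConductorNoZenoFullSheafDualCech
import HarnessLib

/-!
# Crux `NoZenoR` (stmt-ResolutionOfSingularities-19943), line `sandwich-cluster`, G-layer:
# **G2-MAIN** `exists_locallyFree_stableEnd_equiv_cechMH1` — `End̲_T(M) ≃ₗ[T] Ȟ¹(𝒰, F)`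

OURS (cell res-hironaka, chain W4.4; KERNEL-L0 §16 RULING R6 row G2 «full-sheaf package», holder
res-D-pv-045 AS res-L0-w44-stub-8; the statement is G2-MAIN v2 of `D/res-D-pv-045/SketchG2.lean`
(15303e1ccc23c36a), ADOPTED by the lead res-L0-w44-lead-1 as the G2 hypothesis `hG2` of the Ga assembly
`caCarried_tower_of_inputs` and the (S1) stand-in of `CloseG4Draft.lean`). Nothing of
[claim: Hironaka2017] is used; AI-written, weaker than expert review.

**Theorem (G2-MAIN).** Let `T` be a noetherian normal local domain of Krull dimension `2`,
`π : X → Spec T` a resolution of singularities (`X` integral, locally noetherian) with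
`Ȟ¹(𝒰, 𝒪_X) = 0` on finite affine covers (`HasTrivialCechH1 π`), and assume the named fact
`GortzWedhorn2023_24_44_H2` (Görtz–Wedhorn II Cor. 24.44 = EGA III (4.2.2): `Ȟ² = 0` above the fibre
dimension). Then for every finite reflexive `T`-module `M` with `Ext¹_T(M, T) = 0` there is a finite
locally free, affine-localizing, affine-finite-type `𝒪_X`-module `F` with
`End̲_T(M) = End_T(M)/P(M, M) ≃ₗ[T] Ȟ¹(𝒰, F)` for EVERY finite affine open cover `𝒰` of `X`.

Proof = `exists_locallyFree_stableEnd_equiv_cechMH1_of_inputs` (the holder's assembly A4/A5/A7,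
`…G2Assembly`, p512050: `F = 𝓗om(M~, 𝒦)` for a presentation `0 → 𝒦 → 𝒪_X^N → M~ → 0` of the full
sheaf `M~ = 𝒪_X · φ(M)`, `δ : End_T(M) = Ȟ⁰(𝓔nd M~) ↠ Ȟ¹(𝓗om(M~, 𝒦))` with kernel `P(M, M)`) fed with
the two typed inputs of the G2 split, now tree theorems:
(iv) `fullSheaf_isFiniteLocallyFree` (res-L0-w44-stub-1, p510095/p510783: `M~` is a vector bundle —
Hartogs for reflexive modules, stalks free over the regular surface `X`, Görtz–Wedhorn 24.44 through
(iii) `fullSheaf_cechMH1_subsingleton`, res-D-pv-024 p505917) and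
(vii) `fullSheaf_dual_cechMH1_subsingleton` (res-D-pv-024, p510810: `Ȟ¹(𝒰, M~^∨) = 0` from
`Ext¹_T(M, T) = 0` by dualising the presentation); (ii) `Γ(X, M~) = M` is res-D-pv-053's
`fullSheaf_range_linear_eq_of_isScalarTower` (p508324), used inside the assembly.
This is the homological form of M. Artin, J.-L. Verdier, *Reflexive modules over rational double
points*, Math. Ann. 270 (1985) 79–82, Lemma (1.1) [`ArtinVerdier1985`] — there for rational double points
over `ℂ`; here for any resolution of a two-dimensional normal local domain with `H¹(𝒪_X) = 0`, in all
characteristics, which is what the sandwich-cluster line needs at the rational stages of the tower.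
[this work]
-/

-- single-problem summit: the doubled namespace component `ResolutionOfSingularities` is forced
set_option linter.dupNamespace false

noncomputable section

open CategoryTheory AlgebraicGeometry TopologicalSpace
open Literature.AlgebraicGeometry.Resolution Literature.AlgebraicGeometry.Morphisms
open Literature.AlgebraicGeometry.Modules
open Literature.AlgebraicGeometry.Motives (IsFiniteLocallyFree)

namespace Summit.ResolutionOfSingularities.ResolutionOfSingularities.Theorems.NoZeno.SandwichCluster.FullSheaf

/-- **G2-MAIN: `End̲_T(M) ≃ₗ[T] Ȟ¹(𝒰, F)` for a finite locally free `F` on the resolution.** For `T` a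
noetherian normal local domain of Krull dimension `2`, `π : X → Spec T` a resolution with
`Ȟ¹(𝒰, 𝒪_X) = 0` on finite affine covers, the named fact `GortzWedhorn2023_24_44_H2`, and `M` a finite
reflexive `T`-module with `Ext¹_T(M, T) = 0`: there is a finite locally free, affine-localizing,
affine-finite-type `𝒪_X`-module `F` (namely `𝓗om(M~, 𝒦)` for a presentation `𝒪_X^N ↠ M~` of the full
sheaf `M~` of `M`, kernel `𝒦`) such that `End̲_T(M) = End_T(M) ⧸ P(M, M) ≃ₗ[T] Ȟ¹(𝒰, F)` for every
finite affine open cover `𝒰` of `X`. Assembly `…_of_inputs` + (iv) `fullSheaf_isFiniteLocallyFree`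
+ (vii) `fullSheaf_dual_cechMH1_subsingleton`. [this work] -/
theorem exists_locallyFree_stableEnd_equiv_cechMH1
    (T : Type) [CommRing T] [IsDomain T] [IsNoetherianRing T] [IsLocalRing T] [IsIntegrallyClosed T]
    (hdim : ringKrullDim T = 2) (h24 : GortzWedhorn2023_24_44_H2.{0})
    (X : Scheme.{0}) [IsIntegral X] [IsLocallyNoetherian X] (π : X ⟶ Spec (.of T))
    (hπ : IsResolution π) (hrat : HasTrivialCechH1 π)
    (M : Type) [AddCommGroup M] [Module T M] [Module.Finite T M] (hM : Module.IsReflexive T M)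
    (hW : ∀ e : Abelian.Ext (ModuleCat.of T M) (ModuleCat.of T T) 1, e = 0) :
    ∃ F : X.Modules, IsFiniteLocallyFree F ∧ IsAffineLocalizing F ∧ IsAffineFiniteType F ∧
      ∀ (ι : Type) [Finite ι] (U : ι → X.Opens), (∀ i, IsAffineOpen (U i)) → ⨆ i, U i = ⊤ →
        Nonempty (StableEnd T M ≃ₗ[T] CechMH1 π F U) :=
  exists_locallyFree_stableEnd_equiv_cechMH1_of_inputs π M hπ hM
    (fun _ φ hφ hφinj => fullSheaf_isFiniteLocallyFree T X π M φ hdim hπ hrat h24 hM hφ hφinj)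
    (fun _ φ hφ hφinj _ _ U hU hcov =>
      fullSheaf_dual_cechMH1_subsingleton T X π M φ hπ hrat hW hφ hφinj U hU hcov)

end Summit.ResolutionOfSingularities.ResolutionOfSingularities.Theorems.NoZeno.SandwichCluster.FullSheaf

end
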